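import Summits.ResolutionOfSingularities.ResolutionOfSingularities.Theorems.PurelyInseparableDim4ResConeLightVirtualStep
import Summits.ResolutionOfSingularities.ResolutionOfSingularities.Theorems.PurelyInseparableDim4ResConeRepresentationSockets
import HarnessLib
import HarnessLib.Audit.Tags

/-!
# Purely inseparable four-folds — NO LIGHT `(5,3)` BINARY-CONE TAIL: every light tail is re-presented LOSS-FREE by an honest
# witnessed chain read off the polar kernels (hN4-C DISCHARGED), and C13 ends it
# (cell `res-dim4-pi`, K2(p) lane, slice C; light-lossy class = hN4-C, kernel seat res-dim4-p-1 g5, FILE 4b of 4)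

[OURS · counted 0 · cell `res-dim4-pi` · K2(p) lane (holder res-dim4-p-12 g4: socket `ResCone.no_light_three_tail_of_representation`
p703603, «hN4-C is YOUR binder target verbatim»; route of record «LIGHT-LOSSY = C13 ∘ RE-PRESENTATION (hN4-C)», res-dim4-idea-1 g7
2026-08-29 06:24:43Z) · seat res-dim4-p-1 g5.]  Nothing here proves K2(5) (`RidgeBudget.NoAboveFloorTrap 5 5`), `NoIsolatedTrap 5 5`
or resolution of singularities in dimension ≥ 4 / characteristic `p` — NOT proved.  What IS proved: the light `(5,3)` binary-cone
class (shade `≡ 3`, `e_G ≡ 2`, weights `≤ 1`, `|r| = 3`) carries NO witnessed isolated above-floor `Step0 5` chain — loss-free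
(C13, res-dim4-p-5 g3) or LOSSY.  AI kernel work, weaker than expert review.

* §1 `exists_virtual_data` — the VIRTUAL CHAIN generated from `c (k₀+1)`: at each real step the virtual state steps in the chart
  of the (pulled-back) boundary letter hit by the real direction, translating its fixed free letter `φ` by the scalar READ OFF ITS
  OWN POLAR KERNEL (`Classical.epsilon`; FILE 1 makes the reading unique, FILE 2 makes it the right one); the letter bijection
  composes with `swap(x, πφ)` at a lossy step.  Plain `Nat.rec`, no `def`.
* §2 **`virtual_inv`** — along the virtual chain the invariant of FILE 4a holds for every `t` (induction; `inv_step_lossfree` /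
  `inv_step_lossy`); `virtual_translation_spec` — the chart letter is a boundary letter and the chosen translation is a kernel
  reading.
* §3 **`light_lossfree_representation`** = THE SOCKET BINDER hN4-C VERBATIM (for the field at hand): every light `(5,3)`
  binary-cone tail admits a LOSS-FREE re-presentation with the same tail data (the virtual chain: isolated of order `6`, `e_G = 2`
  by FILE 4a `read_of_inv`; witnessed `Step0 5` steps by FILE 3; shade `3`; translations on the free letter only);
  **`no_light_tail_three_five`** — THE THEOREM: no light `(5,3)` binary-cone tail exists
  (`ResCone.no_light_three_tail_of_representation light_lossfree_representation`, i.e. C13 `no_lossfree_tail` on the virtual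
  chain).
[cite: CossartJannsenSaito2020, Thm. 3.10(4), Thm. 3.14] [cite: Hauser2010, §§F–G] [cite: HauserPerlega2019PRIMS, §2 (transform D′ of D)]
bears_on: LADDER-RESOLUTION:D157-DOOR2 (res-dim4-pi · K2(p) · slice C · light-lossy (5,3) = hN4-C DISCHARGED · FILE 4b).
Supports stmt-ResolutionOfSingularities-16155 (helper).
-/

set_option linter.dupNamespace false -- mandated namespace of this single-conjunct summit

noncomputable section

namespace Summit.ResolutionOfSingularities.ResolutionOfSingularities.Theorems.PIDim4

namespace ResCone

namespace LightRep

open MvPolynomial Finset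
open Literature.AlgebraicGeometry.Resolution
open Literature.AlgebraicGeometry.Resolution.CentreBlowup
open Literature.AlgebraicGeometry.Resolution.Hauser2010
open Literature.AlgebraicGeometry.Resolution.HauserPerlega2019
open PointBlowup (polarMap additiveSubspace direction)

variable {K : Type} [Field K]

/-! ## 1. The virtual chain -/

/-- A light boundary has a free letter. [folklore] -/
theorem exists_free_letter {r : Fin 4 →₀ ℕ} (h1 : ∀ i, r i ≤ 1) (hdeg : r.degree = 3) : ∃ y, r y = 0 := by
  by_contra h
  push Not at h
  have h4 : r.degree = 4 := by
    rw [Finsupp.degree_eq_sum, Finset.sum_congr rfl (fun i _ => show r i = 1 by have := h1 i; have := h i; omega),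
      Finset.sum_const, smul_eq_mul, mul_one, Finset.card_univ, Fintype.card_fin]
  omega

/-- **THE VIRTUAL CHAIN DATA** (module docstring §1): letter bijections `πs`, states `Bs`, chart letters `ℓs`, translations `γs`
generated from `c k₁` by the recursion rule; the translation is ANY kernel reading when one exists (`Classical.epsilon`).
[OURS · bookkeeping] -/
theorem exists_virtual_data [DecidableEq K] (c : ℕ → State K) (j : ℕ → Fin 4) (b : ℕ → Fin 4 → K) (k₁ : ℕ) (φ : Fin 4) :
    ∃ (πs : ℕ → Equiv.Perm (Fin 4)) (Bs : ℕ → State K) (ℓs : ℕ → Fin 4) (γs : ℕ → K),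
      πs 0 = 1 ∧ Bs 0 = c k₁ ∧
      (∀ t, ℓs t = (πs t).symm (if (c (k₁ + t)).r (j (k₁ + t)) = 0
          then Classical.epsilon (fun i => b (k₁ + t) i ≠ 0) else j (k₁ + t))) ∧
      (∀ t, (∃ γ : K, (Pi.single (ℓs t) 1 : Fin 4 → K) + γ • (Pi.single φ 1 : Fin 4 → K) ∈ resVertex (Bs t)) →
          (Pi.single (ℓs t) 1 : Fin 4 → K) + γs t • (Pi.single φ 1 : Fin 4 → K) ∈ resVertex (Bs t)) ∧
      (∀ t, Bs (t + 1) = CentreBlowup.step 5 Finset.univ (ℓs t) (Pi.single φ (γs t) : Fin 4 → K) (Bs t)) ∧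
      (∀ t, πs (t + 1) = if (c (k₁ + t)).r (j (k₁ + t)) = 0
          then (πs t).trans (Equiv.swap (Classical.epsilon (fun i => b (k₁ + t) i ≠ 0)) ((πs t) φ)) else πs t) := by
  -- the hit letter of the real step `k₁ + t`
  let x : ℕ → Fin 4 := fun t =>
    if (c (k₁ + t)).r (j (k₁ + t)) = 0 then Classical.epsilon (fun i => b (k₁ + t) i ≠ 0) else j (k₁ + t)
  -- one step of the recursion on (bijection, state)
  let nxt : ℕ → Equiv.Perm (Fin 4) × State K → Equiv.Perm (Fin 4) × State K := fun t q =>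
    ((if (c (k₁ + t)).r (j (k₁ + t)) = 0
        then q.1.trans (Equiv.swap (Classical.epsilon (fun i => b (k₁ + t) i ≠ 0)) (q.1 φ)) else q.1),
      CentreBlowup.step 5 Finset.univ (q.1.symm (x t))
        (Pi.single φ (Classical.epsilon (fun γ : K =>
          (Pi.single (q.1.symm (x t)) 1 : Fin 4 → K) + γ • (Pi.single φ 1 : Fin 4 → K) ∈ resVertex q.2)) : Fin 4 → K)
        q.2)
  let Φ : ℕ → Equiv.Perm (Fin 4) × State K := fun t => Nat.rec ((1 : Equiv.Perm (Fin 4)), c k₁) nxt t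
  refine ⟨fun t => (Φ t).1, fun t => (Φ t).2, fun t => (Φ t).1.symm (x t),
    fun t => Classical.epsilon (fun γ : K =>
      (Pi.single ((Φ t).1.symm (x t)) 1 : Fin 4 → K) + γ • (Pi.single φ 1 : Fin 4 → K) ∈ resVertex (Φ t).2),
    rfl, rfl, fun t => rfl, fun t h => Classical.epsilon_spec h, fun t => rfl, fun t => rfl⟩

/-! ## 2. The invariant along the virtual chain -/

section Chain

variable [CharP K 5] [DecidableEq K]

omit [CharP K 5] in
/-- At a lossy real step some letter is translated. [OURS · bookkeeping] -/
theorem exists_translated_of_lossy {c : ℕ → State K} {j : ℕ → Fin 4} {b : ℕ → Fin 4 → K}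
    (hc : ∀ k, IsIsolated 5 (c k).F ∧ Step0 5 (c k) (c (k + 1))) (hw : FreeTail.IsWitnessedChain 5 c j b)
    (hr0 : ∀ e ∈ (c 0).F.support, (c 0).r ≤ e) (hfloor : ∀ k, ordZero (c k).F ≠ 5) {k₀ : ℕ}
    (hshade : ∀ k, k₀ ≤ k → (c k).shade = ((3 : ℕ) : ℕ∞))
    (hlight : ∀ k, k₀ ≤ k → (∀ i, (c k).r i ≤ 1) ∧ (c k).r.degree = 3) {k : ℕ} (hk : k₀ ≤ k)
    (hj0 : (c k).r (j k) = 0) : ∃ x, b k x ≠ 0 := by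
  rcases light_step_cases hc hw hr0 hfloor hshade hlight hk with ⟨hj1, -⟩ | ⟨-, hdeg1⟩
  · rw [hj0] at hj1; exact absurd hj1 zero_ne_one
  · have hne : (c k).r.filter (fun i => ¬ b k i = 0) ≠ 0 := by
      intro h0; rw [h0, map_zero] at hdeg1; exact zero_ne_one hdeg1
    obtain ⟨x, hx⟩ := Finsupp.ne_iff.mp hne
    rw [Finsupp.filter_apply, Finsupp.coe_zero, Pi.zero_apply] at hx
    by_cases hbx : b k x = 0
    · rw [if_neg (not_not.mpr hbx)] at hx; exact absurd rfl hx
    · exact ⟨x, hbx⟩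

/-- **ONE STEP OF THE VIRTUAL CHAIN, both cases**: from the invariant at `t` (real time `k`), the virtual chart letter `ℓ` is a
boundary letter (`ℓ ≠ φ`), a kernel reading exists, and for the chosen reading `γ′` the invariant holds at real time `k + 1` for
`step_ℓ(γ′·e_φ) B` along the updated bijection. [OURS] [cite: CossartJannsenSaito2020, Thm. 3.14] -/
theorem virtual_translation_spec {c : ℕ → State K} {j : ℕ → Fin 4} {b : ℕ → Fin 4 → K}
    (hc : ∀ k, IsIsolated 5 (c k).F ∧ Step0 5 (c k) (c (k + 1))) (hw : FreeTail.IsWitnessedChain 5 c j b)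
    (hr0 : ∀ e ∈ (c 0).F.support, (c 0).r ≤ e) (hfloor : ∀ k, ordZero (c k).F ≠ 5) {k₀ : ℕ}
    (hshade : ∀ k, k₀ ≤ k → (c k).shade = ((3 : ℕ) : ℕ∞))
    (he : ∀ k, k₀ ≤ k → Module.finrank K (resVertex (c k)) = 2)
    (hlight : ∀ k, k₀ ≤ k → (∀ i, (c k).r i ≤ 1) ∧ (c k).r.degree = 3) {k : ℕ} (hk : k₀ ≤ k)
    {π : Equiv.Perm (Fin 4)} {φ : Fin 4} (hφ : (c k).r (π φ) = 0) {B : State K}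
    (hrB : ∀ i, B.r i = if i = φ then 0 else 1)
    (hrel : ∀ M : ℕ, ∃ (θ e : Fin 4 → MvPolynomial (Fin 4) K) (G U E : MvPolynomial (Fin 4) K),
      (∀ i, i ≠ φ → θ (π i) = X i * e i) ∧ θ (π φ) = X φ * e φ + G ∧ (∀ i, constantCoeff (e i) ≠ 0) ∧
      constantCoeff G = 0 ∧ coeff (Finsupp.single φ 1) G = 0 ∧ constantCoeff U ≠ 0 ∧ E ∈ originIdeal K ^ M ∧
      B.F = deletePthPowers 5 (U ^ 5 * aeval θ (c k).F) + E)
    {ℓ : Fin 4} (hℓ : ℓ = π.symm (if (c k).r (j k) = 0 then Classical.epsilon (fun i => b k i ≠ 0) else j k))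
    {γ' : K} (hγ' : (∃ γ : K, (Pi.single ℓ 1 : Fin 4 → K) + γ • (Pi.single φ 1 : Fin 4 → K) ∈ resVertex B) →
      (Pi.single ℓ 1 : Fin 4 → K) + γ' • (Pi.single φ 1 : Fin 4 → K) ∈ resVertex B) :
    ℓ ≠ φ ∧ (Pi.single ℓ 1 : Fin 4 → K) + γ' • (Pi.single φ 1 : Fin 4 → K) ∈ resVertex B ∧
    (c (k + 1)).r ((if (c k).r (j k) = 0
        then π.trans (Equiv.swap (Classical.epsilon (fun i => b k i ≠ 0)) (π φ)) else π) φ) = 0 ∧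
    (∀ i, (CentreBlowup.step 5 Finset.univ ℓ (Pi.single φ γ' : Fin 4 → K) B).r i = if i = φ then 0 else 1) ∧
    ∀ M : ℕ, ∃ (θ e : Fin 4 → MvPolynomial (Fin 4) K) (G U E : MvPolynomial (Fin 4) K),
      (∀ i, i ≠ φ → θ ((if (c k).r (j k) = 0
          then π.trans (Equiv.swap (Classical.epsilon (fun i => b k i ≠ 0)) (π φ)) else π) i) = X i * e i) ∧
      θ ((if (c k).r (j k) = 0
          then π.trans (Equiv.swap (Classical.epsilon (fun i => b k i ≠ 0)) (π φ)) else π) φ) = X φ * e φ + G ∧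
      (∀ i, constantCoeff (e i) ≠ 0) ∧ constantCoeff G = 0 ∧ coeff (Finsupp.single φ 1) G = 0 ∧ constantCoeff U ≠ 0 ∧
      E ∈ originIdeal K ^ M ∧
      (CentreBlowup.step 5 Finset.univ ℓ (Pi.single φ γ' : Fin 4 → K) B).F =
        deletePthPowers 5 (U ^ 5 * aeval θ (c (k + 1)).F) + E := by
  by_cases h0 : (c k).r (j k) = 0
  · -- lossy real step
    obtain ⟨x₀, hx₀⟩ := exists_translated_of_lossy hc hw hr0 hfloor hshade hlight hk h0
    have hbx : b k (Classical.epsilon (fun i => b k i ≠ 0)) ≠ 0 := Classical.epsilon_spec (p := fun i => b k i ≠ 0) ⟨x₀, hx₀⟩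
    rw [if_pos h0] at hℓ
    have hπℓ : π ℓ = Classical.epsilon (fun i => b k i ≠ 0) := by rw [hℓ, Equiv.apply_symm_apply]
    obtain ⟨hℓφ, hex, hstep⟩ := inv_step_lossy hc hw hr0 hfloor hshade he hlight hk hφ hrB hrel h0 hbx hπℓ
    have hmem := hγ' hex
    obtain ⟨h1, h2, h3⟩ := hstep γ' hmem
    simp only [if_pos h0]
    exact ⟨hℓφ, hmem, h1, h2, h3⟩
  · -- loss-free real step
    have h1' : (c k).r (j k) = 1 := by have := (hlight k hk).1 (j k); omega
    rw [if_neg h0] at hℓ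
    have hπℓ : π ℓ = j k := by rw [hℓ, Equiv.apply_symm_apply]
    obtain ⟨hℓφ, hex, hstep⟩ := inv_step_lossfree hc hw hr0 hfloor hshade he hlight hk hφ hrB hrel h1' hπℓ
    have hmem := hγ' hex
    obtain ⟨h1, h2, h3⟩ := hstep γ' hmem
    simp only [if_neg h0]
    exact ⟨hℓφ, hmem, h1, h2, h3⟩

/-- **THE INVARIANT ALONG THE VIRTUAL CHAIN** (induction on `t` from the identity relation at `c (k₀+1)`). [OURS]
[cite: CossartJannsenSaito2020, Thm. 3.14] -/
theorem virtual_inv {c : ℕ → State K} {j : ℕ → Fin 4} {b : ℕ → Fin 4 → K}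
    (hc : ∀ k, IsIsolated 5 (c k).F ∧ Step0 5 (c k) (c (k + 1))) (hw : FreeTail.IsWitnessedChain 5 c j b)
    (hr0 : ∀ e ∈ (c 0).F.support, (c 0).r ≤ e) (hfloor : ∀ k, ordZero (c k).F ≠ 5) {k₀ : ℕ}
    (hshade : ∀ k, k₀ ≤ k → (c k).shade = ((3 : ℕ) : ℕ∞))
    (he : ∀ k, k₀ ≤ k → Module.finrank K (resVertex (c k)) = 2)
    (hlight : ∀ k, k₀ ≤ k → (∀ i, (c k).r i ≤ 1) ∧ (c k).r.degree = 3) {φ : Fin 4} (hφ : (c (k₀ + 1)).r φ = 0)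
    {πs : ℕ → Equiv.Perm (Fin 4)} {Bs : ℕ → State K} {ℓs : ℕ → Fin 4} {γs : ℕ → K} (h0π : πs 0 = 1)
    (h0B : Bs 0 = c (k₀ + 1))
    (hℓ : ∀ t, ℓs t = (πs t).symm (if (c (k₀ + 1 + t)).r (j (k₀ + 1 + t)) = 0
          then Classical.epsilon (fun i => b (k₀ + 1 + t) i ≠ 0) else j (k₀ + 1 + t)))
    (hγ : ∀ t, (∃ γ : K, (Pi.single (ℓs t) 1 : Fin 4 → K) + γ • (Pi.single φ 1 : Fin 4 → K) ∈ resVertex (Bs t)) →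
          (Pi.single (ℓs t) 1 : Fin 4 → K) + γs t • (Pi.single φ 1 : Fin 4 → K) ∈ resVertex (Bs t))
    (hB : ∀ t, Bs (t + 1) = CentreBlowup.step 5 Finset.univ (ℓs t) (Pi.single φ (γs t) : Fin 4 → K) (Bs t))
    (hπ : ∀ t, πs (t + 1) = if (c (k₀ + 1 + t)).r (j (k₀ + 1 + t)) = 0
          then (πs t).trans (Equiv.swap (Classical.epsilon (fun i => b (k₀ + 1 + t) i ≠ 0)) ((πs t) φ)) else πs t)
    (t : ℕ) :
    (c (k₀ + 1 + t)).r ((πs t) φ) = 0 ∧ (∀ i, (Bs t).r i = if i = φ then 0 else 1) ∧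
    ∀ M : ℕ, ∃ (θ e : Fin 4 → MvPolynomial (Fin 4) K) (G U E : MvPolynomial (Fin 4) K),
      (∀ i, i ≠ φ → θ ((πs t) i) = X i * e i) ∧ θ ((πs t) φ) = X φ * e φ + G ∧ (∀ i, constantCoeff (e i) ≠ 0) ∧
      constantCoeff G = 0 ∧ coeff (Finsupp.single φ 1) G = 0 ∧ constantCoeff U ≠ 0 ∧ E ∈ originIdeal K ^ M ∧
      (Bs t).F = deletePthPowers 5 (U ^ 5 * aeval θ (c (k₀ + 1 + t)).F) + E := by
  haveI : Fact (Nat.Prime 5) := ⟨by norm_num⟩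
  induction t with
  | zero =>
    rw [h0π, h0B]
    obtain ⟨-, -, hrA', -⟩ := real_facts hc hw hr0 hfloor hshade hlight (show k₀ ≤ k₀ + 1 by omega) hφ
    refine ⟨hφ, hrA', fun M => ?_⟩
    have hclean : deletePthPowers 5 (c (k₀ + 1)).F = (c (k₀ + 1)).F := by
      rw [(hw k₀).2.2.2.2]; exact deletePthPowers_step 5 Finset.univ (j k₀) (b k₀) (c k₀)
    exact SwapNorm.rel_refl 5 φ M hclean
  | succ t ih =>
    obtain ⟨hφt, hrBt, hrelt⟩ := ih
    obtain ⟨-, -, h1, h2, h3⟩ := virtual_translation_spec hc hw hr0 hfloor hshade he hlight (show k₀ ≤ k₀ + 1 + t by omega)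
      hφt hrBt hrelt (hℓ t) (hγ t)
    rw [hπ t, hB t]
    exact ⟨h1, h2, h3⟩

end Chain

/-! ## 3. The theorems -/

section Main

variable [CharP K 5] [DecidableEq K]

/-- **hN4-C DISCHARGED — EVERY LIGHT `(5,3)` BINARY-CONE TAIL IS RE-PRESENTED LOSS-FREE** (the binder of
`ResCone.no_light_three_tail_of_representation`, verbatim): for every witnessed isolated above-floor `Step0 5` chain with
`x^{r₀} ∣ F₀`, shade `≡ 3`, `e_G ≡ 2` and light boundary from `k₀`, there is a witnessed isolated above-floor `Step0 5` chain
(`x^{r₀′} ∣ F₀′`, shade `≡ 3`, `e_G ≡ 2` from `0`) whose translations never touch a boundary letter — the virtual chain of §1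
read through FILE 4a. [OURS] [cite: CossartJannsenSaito2020, Thm. 3.10(4), Thm. 3.14] [cite: Hauser2010, §§F–G] -/
theorem light_lossfree_representation :
    ∀ (c : ℕ → State K) (j : ℕ → Fin 4) (b : ℕ → Fin 4 → K),
      (∀ k, IsIsolated 5 (c k).F ∧ Step0 5 (c k) (c (k + 1))) → FreeTail.IsWitnessedChain 5 c j b →
      (∀ e ∈ (c 0).F.support, (c 0).r ≤ e) → (∀ k, ordZero (c k).F ≠ (5 : ℕ)) →
      ∀ k₀ : ℕ, (∀ k, k₀ ≤ k → (c k).shade = ((3 : ℕ) : ℕ∞)) →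
      (∀ k, k₀ ≤ k → Module.finrank K (resVertex (c k)) = 2) →
      (∀ k, k₀ ≤ k → (∀ i, (c k).r i ≤ 1) ∧ (c k).r.degree = 3) →
      ∃ (c' : ℕ → State K) (j' : ℕ → Fin 4) (b' : ℕ → Fin 4 → K) (k₀' : ℕ),
        (∀ k, IsIsolated 5 (c' k).F ∧ Step0 5 (c' k) (c' (k + 1))) ∧ FreeTail.IsWitnessedChain 5 c' j' b' ∧
        (∀ e ∈ (c' 0).F.support, (c' 0).r ≤ e) ∧ (∀ k, ordZero (c' k).F ≠ (5 : ℕ)) ∧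
        (∀ k, k₀' ≤ k → (c' k).shade = ((3 : ℕ) : ℕ∞)) ∧
        (∀ k, k₀' ≤ k → Module.finrank K (resVertex (c' k)) = 2) ∧
        (∀ k, k₀' ≤ k → ∀ i, b' k i ≠ 0 → (c' k).r i = 0) := by
  intro c j b hc hw hr0 hfloor k₀ hshade he hlight
  haveI : Fact (Nat.Prime 5) := ⟨by norm_num⟩
  have hfloor' : ∀ k, ordZero (c k).F ≠ 5 := fun k => by exact_mod_cast hfloor k
  obtain ⟨φ, hφ⟩ := exists_free_letter (hlight (k₀ + 1) (by omega)).1 (hlight (k₀ + 1) (by omega)).2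
  obtain ⟨πs, Bs, ℓs, γs, h0π, h0B, hℓ, hγ, hB, hπ⟩ := exists_virtual_data c j b (k₀ + 1) φ
  have hinv := virtual_inv hc hw hr0 hfloor' hshade he hlight hφ h0π h0B hℓ hγ hB hπ
  -- per-time readings
  have hspec : ∀ t, ℓs t ≠ φ ∧ (Pi.single (ℓs t) 1 : Fin 4 → K) + γs t • (Pi.single φ 1 : Fin 4 → K) ∈ resVertex (Bs t) :=
    fun t => by
      obtain ⟨h1, h2, -⟩ := virtual_translation_spec hc hw hr0 hfloor' hshade he hlight (show k₀ ≤ k₀ + 1 + t by omega)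
        (hinv t).1 (hinv t).2.1 (hinv t).2.2 (hℓ t) (hγ t)
      exact ⟨h1, h2⟩
  have hread : ∀ t, IsIsolated 5 (Bs t).F ∧ ordZero (Bs t).F = ((6 : ℕ) : ℕ∞) ∧ Module.finrank K (resVertex (Bs t)) = 2 :=
    fun t => read_of_inv hc hw hr0 hfloor' hshade he hlight (show k₀ ≤ k₀ + 1 + t by omega) (hinv t).1 (hinv t).2.1
      (hinv t).2.2
  have hB5 : ∀ t, (5 : ℕ∞) ≤ ordAlong Finset.univ (Bs t).F := fun t => by
    rw [ordAlong_univ, (hread t).2.1]; exact_mod_cast (by norm_num : 5 ≤ 6)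
  have hnext : ∀ t, ordZero (CentreBlowup.step 5 Finset.univ (ℓs t) (Pi.single φ (γs t) : Fin 4 → K) (Bs t)).F =
      ((6 : ℕ) : ℕ∞) := fun t => by rw [← hB t]; exact (hread (t + 1)).2.1
  refine ⟨Bs, ℓs, fun t => Pi.single φ (γs t), 0, fun t => ⟨(hread t).1, ?_⟩, fun t => ?_, ?_, fun t => ?_,
    fun t _ => ?_, fun t _ => (hread t).2.2, fun t _ i hi => ?_⟩
  · rw [hB t]; exact step0_of_ordZero 5 (hB5 t) (hspec t).1 (γs t) (hnext t) (by norm_num)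
  · obtain ⟨h1, h2, h3, h4⟩ := witnessed_step_of_ordZero 5 (hB5 t) (hspec t).1 (γs t) (hnext t) (by norm_num)
    exact ⟨h1, h2, h3, h4, hB t⟩
  · rw [h0B]; exact IsolatedBand.isolated_chain_forall_le hc hr0 (k₀ + 1)
  · rw [(hread t).2.1]; exact_mod_cast (by norm_num : (6 : ℕ) ≠ 5)
  · change ordZero (Bs t).F - ((Bs t).r.degree : ℕ∞) = ((3 : ℕ) : ℕ∞)
    rw [(hread t).2.1, (light_of_r_apply (hinv t).2.1).2, ← ENat.coe_sub]
  · by_contra hri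
    by_cases hiφ : i = φ
    · rw [hiφ, (hinv t).2.1 φ, if_pos rfl] at hri; exact hri rfl
    · exact hi (Pi.single_eq_of_ne hiφ _)

/-- **NO LIGHT `(5,3)` BINARY-CONE TAIL** (loss-free OR lossy): there is no witnessed isolated above-floor `Step0 5` chain with
`x^{r₀} ∣ F₀`, constant shade `3`, `e_G ≡ 2` and light boundary (all weights `≤ 1`, `|r| = 3`) from some `k₀` — the holder's socket
`ResCone.no_light_three_tail_of_representation` (p703603) with hN4-C discharged by `light_lossfree_representation`, i.e. C13
`ResCone.no_lossfree_tail` (res-dim4-p-5 g3) on the virtual chain.  This closes the light-lossy class of res-dim4-p-12 g4's memo §17 /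
L0 `…ResConeLightLossyStep`.  Nothing here proves K2(5) or resolution of singularities in dim ≥ 4 / char `p`. [OURS]
[cite: CossartJannsenSaito2020, Thm. 3.10(4), Thm. 3.14] -/
theorem no_light_tail_three_five (c : ℕ → State K) (j : ℕ → Fin 4) (b : ℕ → Fin 4 → K)
    (hc : ∀ k, IsIsolated 5 (c k).F ∧ Step0 5 (c k) (c (k + 1))) (hw : FreeTail.IsWitnessedChain 5 c j b)
    (hr0 : ∀ e ∈ (c 0).F.support, (c 0).r ≤ e) (hfloor : ∀ k, ordZero (c k).F ≠ (5 : ℕ)) (k₀ : ℕ)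
    (hshade : ∀ k, k₀ ≤ k → (c k).shade = ((3 : ℕ) : ℕ∞))
    (he : ∀ k, k₀ ≤ k → Module.finrank K (resVertex (c k)) = 2)
    (hlight : ∀ k, k₀ ≤ k → (∀ i, (c k).r i ≤ 1) ∧ (c k).r.degree = 3) : False :=
  no_light_three_tail_of_representation light_lossfree_representation c j b hc hw hr0 hfloor k₀ hshade he hlight

end Main

end LightRep

end ResCone

end Summit.ResolutionOfSingularities.ResolutionOfSingularities.Theorems.PIDim4

end
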